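import Summits.MatrixMultiplication.OmegaCensus.STPP211Z2pow6CoverEngine

/-!
# (2,1,1)¹⁰ ⊄ (ℤ/2)⁶ — part H3d3: the cover decisions, frames with `d = 6` (chunks 3–5 of 5)

Cell `pub-omega` (unit `pub-omega-stpp-1-g37`), topic `Summits/MatrixMultiplication/OmegaCensus`.
HONEST FRAMING (verbatim): lottery ticket; floor = certified bounds/negative ranges. Census STRUCTURE bookkeeping (B5, `T1((ℤ/2)⁶)`, Pb237);
nothing here is a bound on `ω`.

Kernel decisions of `coverOne` (`STPP211Z2pow6CoverEngine`) over chunks of the enumeration `(freeCodes d).sublistsLen (9 − d)` of the free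
parts of the frame normal forms (chunks sized to ≈ 1 kernel-minute); assembled in `STPP211Z2pow6Cover` (`cover_all`, `cover_spec`).

References: H. Cohn, R. Kleinberg, B. Szegedy, C. Umans, FOCS 2005 (arXiv:math/0511460), Def. 5.1.
-/

namespace Summit.MatrixMultiplication.OmegaCensus

namespace T1Z2p6

/-- KERNEL: frames with `d = 6`, chunk 3 (frames 11 705 – 17 556) pass the cover check. -/
theorem cover6c : ((((freeCodes 6).sublistsLen 3).drop 11704).take 5852).all (coverOne 6) = true := by decide +kernel

/-- KERNEL: frames with `d = 6`, chunk 4 (frames 17 557 – 23 408) pass the cover check. -/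
theorem cover6d : ((((freeCodes 6).sublistsLen 3).drop 17556).take 5852).all (coverOne 6) = true := by decide +kernel

/-- KERNEL: frames with `d = 6`, chunk 5 (frames 23 409 – 29 260) pass the cover check. -/
theorem cover6e : (((freeCodes 6).sublistsLen 3).drop 23408).all (coverOne 6) = true := by decide +kernel
end T1Z2p6

end Summit.MatrixMultiplication.OmegaCensus
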